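import Literature.NumberTheory.LFunctions.NicolasChainCheck
import HarnessLib

/-!
# RH-FREE — `c(p#) ≥ 2.2088 > c(2)` for the primes `3 ≤ p ≤ 360649` by kernel computation: the checker (Nicolas 2012, Thm. 1.1 (1.7)); nothing here bears on the truth of RH

RH-FREE (a finite computation; nothing here bears on the truth of RH). The computable core of a
kernel certificate for the FINITE range of **Nicolas 2012, Thm. 1.1 (1.7)**, "`c(N_k) ≥ c(N_1) = c(2)`
for every `k ≥ 1`", `c(n) = (n/φ(n) − e^γ log log n)√(log n)` (`Literature.NumberTheory.LFunctions.nicolasC`):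
for every prime `3 ≤ p ≤ 360649` (beyond `599² = 358801` the tree's analytic argument under RH takes
over, `NicolasCLimsupRH.lean` §9), `c(p#) ≥ 2.2088 ≥ c(2) = 2.20858…`. Nicolas settles `k ≤ π(10⁹)` by
a floating-point table (§4); here the range needed by the tree is replayed in the kernel.

It is the Nicolas chain of `NicolasChainCheck.lean` (same prime table `ChainTable.table`, primality
test `ThetaChain.primeChk`, logarithm enclosures `ThetaChain.logNext`, constant `GHI ≥ 2⁸⁰ e^γ`) with
the lower enclosure `Tlo ≤ 2⁸⁰ θ(p)` of the `θ`-chain (`ThetaChainCheck.lean`) restored and a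
quantitative comparison: a state `⟨p, Llo, Lhi, Tlo, Thi, P⟩` records `Llo ≤ 2⁸⁰ log p ≤ Lhi`,
`Tlo ≤ 2⁸⁰ θ(p) ≤ Thi`, `P ≤ 2⁸⁰ ∏_{q ≤ p} q/(q−1)`; a step to the next table entry `p'` certifies its
primality, updates `Tlo' = Tlo + Llo'`, `Thi' = Thi + Lhi'`, `P' = ⌊P p'/(p'−1)⌋` and performs `cChk`:

  `CTWO · 2¹⁶⁰ · p' ≤ (A − B) · ⌊√(Tlo' · 2⁸⁰)⌋`,  `A = (P' + GHI)·p'·2⁸⁰`, `B = GHI·(Lhi'·p' + Thi')`,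

`CTWO = ⌈2.2088 · 2⁸⁰⌉`. Since `A − B ≤ 2¹⁶⁰ p' (Π(p') − e^γ (log p' + θ(p')/p' − 1))`,
`log θ ≤ log p' + θ/p' − 1` and `⌊√(Tlo' 2⁸⁰)⌋ ≤ 2⁸⁰ √θ(p')`, a passed check gives
`c(p'#) = (Π(p') − e^γ log θ(p')) √θ(p') ≥ 2.2088` — see `NicolasCChainSound.lean`; the run is
`NicolasCChainRun.lean`, the assembly (Nicolas 2012, Cor. 1.1 (1.7) as a kernel equivalence)
`NicolasCTwoCriterion.lean`. All arithmetic is on `ℕ` with the kernel's GMP-accelerated primitives.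
Nothing is asserted: the `def`s are computable functions and one constant.

## References

* J.-L. Nicolas, *Small values of the Euler function and the Riemann hypothesis*, Acta Arith. 155
  (2012), 311–321, Thm. 1.1 (1.7) and §4 (the computation of `c(N_k)` for `k ≤ k₀ = π(10⁹)`).
  [Nicolas2012]
-/

namespace Literature.NumberTheory.LFunctions.NicolasCChain

open ChainCheck ChainTable ThetaChain NicolasChain

/-- `CTWO = ⌈2.2088 · 2⁸⁰⌉`, an integer with `CTWO ≥ 2⁸⁰ · 2.2088 ≥ 2⁸⁰ c(2)` (`c(2) = 2.2085892614…`).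
[cite: Nicolas2012, Thm. 1.1 (1.7)] -/
def CTWO : ℕ := 2670275350364792921091002

/-- `cChk p Lhi Tlo Thi P`: the test `CTWO·2¹⁶⁰·p ≤ (A − B)·⌊√(Tlo·2⁸⁰)⌋` with `A = (P + GHI)·p·2⁸⁰`,
`B = GHI·(Lhi·p + Thi)` (truncated subtraction: a passed test forces `B < A`); with `Lhi ≥ 2⁸⁰ log p`,
`Tlo ≤ 2⁸⁰ θ(p) ≤ Thi`, `P ≤ 2⁸⁰ ∏_{q ≤ p} q/(q−1)` and `p ≥ 3` it implies `c(p#) ≥ 2.2088`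
(`NicolasCChain.cChk_sound`). [cite: Nicolas2012, Thm. 1.1 (1.7)] -/
def cChk (p Lhi Tlo Thi P : ℕ) : Bool :=
  Nat.ble (Nat.mul (Nat.mul (Nat.mul CTWO SC) SC) p)
    (Nat.mul (Nat.sub (Nat.mul (Nat.mul (Nat.add P GHI) p) SC) (Nat.mul GHI (Nat.add (Nat.mul Lhi p) Thi)))
      (Nat.sqrt (Nat.mul Tlo SC)))

/-- A state of the `c`-chain: the prime `p` reached, `Llo ≤ 2⁸⁰ log p ≤ Lhi`, `Tlo ≤ 2⁸⁰ θ(p) ≤ Thi`,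
`P ≤ 2⁸⁰ ∏_{q ≤ p} q/(q−1)`. [cite: Nicolas2012, Thm. 1.1 (1.7)] -/
structure NCS where
  /-- the last prime reached -/
  p : ℕ
  /-- lower bound of `2⁸⁰ log p` -/
  Llo : ℕ
  /-- upper bound of `2⁸⁰ log p` -/
  Lhi : ℕ
  /-- lower bound of `2⁸⁰ θ(p)` -/
  Tlo : ℕ
  /-- upper bound of `2⁸⁰ θ(p)` -/
  Thi : ℕ
  /-- lower bound of `2⁸⁰ ∏_{q ≤ p} q/(q−1)` -/
  P : ℕ
  deriving Repr, DecidableEq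

/-- **One step** of the `c`-chain, to the next table entry `p'`: order, parity and primality of
`p'` (`ThetaChain.primeChk`); the new enclosures (`ThetaChain.logNext`, `Tlo' = Tlo + Llo'`,
`Thi' = Thi + Lhi'`, `P' = ⌊P·p'/(p'−1)⌋`); the comparison `cChk` at `p'`. [folklore] -/
def stepC (s : NCS) (p' : ℕ) : Option NCS :=
  match s with
  | ⟨p, Llo, Lhi, Tlo, Thi, P⟩ =>
    bif !(Nat.blt p p' && Nat.beq (Nat.mod p' 2) 1 && primeChk p') then none else
    match logNext p Llo Lhi p' with
    | none => none
    | some (Llo', Lhi') =>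
      let Tlo' := Nat.add Tlo Llo'
      let Thi' := Nat.add Thi Lhi'
      let P' := Nat.div (Nat.mul P p') (Nat.sub p' 1)
      bif cChk p' Lhi' Tlo' Thi' P' then some ⟨p', Llo', Lhi', Tlo', Thi', P'⟩ else none

/-- Run over a segment of the table with fuel (a chunk): stops successfully when the fuel or the
segment is exhausted, fails as soon as a step fails. [folklore] -/
def runC : ℕ → NCS → List ℕ → Option NCS
  | 0, s, _ => some s
  | _ + 1, s, [] => some s
  | fuel + 1, s, p' :: rest =>
    match stepC s p' with
    | none => none
    | some s' => runC fuel s' rest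

/-- The initial state: `p = 2`, `θ(2) = log 2` (`ChainCheck.L2LON ≤ 2⁸⁰ log 2 ≤ ChainCheck.L2HIN`),
`∏_{q ≤ 2} q/(q−1) = 2` (`P = 2·2⁸⁰`). [folklore] -/
def initC : NCS := ⟨2, L2LON, L2HIN, L2LON, L2HIN, Nat.mul 2 SC⟩

/-- **A chunk of the run**: at most `fuel` entries of `ChainTable.table` after the state's prime.
[folklore] -/
def runDC (fuel : ℕ) (s : NCS) : Option NCS := runC fuel s (ChainCheck.after s.p table)

end Literature.NumberTheory.LFunctions.NicolasCChain
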